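import Summits.QuantumFields.YangMills.Theorems.BalabanUVNodesN15CovariantLandauProjection
import Summits.QuantumFields.BalabanUV.T4Continuum.Support.ScalarGaugeProjectionUnit
import HarnessLib

/-!
# Route «BalabanUVNodes», node N15 = NE2, road (c) — PROGRAMME (P-R), IV: «IT COINCIDES WITH `Δ_a` IN (2.19) IF `U = 1`» — AT THE FLAT BACKGROUND THE MODEL's
# `D(I − R)D*` IS b05's LANDAU TERM `∂Π∂*` OF (1.69): `landauFlat = reM (∂·PcT·∂ᴴ)`, hence `landauCov 1 = landauRe ⊗ 1_ι` (dag-n15-c g22, n15-c∕200)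

Cell `pub-ymgap`, seat `pub-ymgap-dag-n15-c` (generation g22; R134 (a), s1; HUMAN RULING D-0062; chair R424 venue).  `bears_on: R4∕N15 · K3⁸ SpineGivenEndpointR13SepCoPHV
(stmt-QuantumFields-27366)`; filed `--supports stmt-QuantumFields-27366 --as helper` — COUNT-NEUTRAL.  Finite linear algebra ([folklore]); no `def`; 0 `sorry`; NO estimate.
Imports BY NAME n15-c∕199 `…N15CovariantLandauProjection` (through it n15-c∕197's objects and `U ≡ 1` dictionary `landauCov_one`∕`piFlat`∕`landauFlat`, n15-a part 46
`landauRe`, b05's `GradOp`∕`LapS`∕`Pker`∕`QsOp`∕`PcT`∕`reM`∕`IsReal`) and — CITED, NOT RESTATED (dedup of record: its `Pker_mul_QsOpH`, `Pone_eq`, `GradOp_mul_Pker` are exactly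
the flat facts this step needs) — the NE2 formalisation swarm's `Summits/QuantumFields/BalabanUV/T4Continuum/Support/ScalarGaugeProjectionUnit` (leaf 09, tier-B row B4.c:
`DeltaPs = Δ + a′·n^{d}Q′ᴴQ′`, `Gps = DeltaPs⁻¹`, `Kone = Q′G′G′Q′ᴴ`, ★ `Pone = G′Q′ᴴKone⁻¹Q′G′`, ★★ `Pone_eq : Pone = PcT + Pker`, `GradOp_mul_Pker`).  Nothing in the tree
modified ∕ restated (the reality of `DeltaPs`∕`Gps` is GAN24's `ScalarFlatLift.isReal_DeltaPs`∕`isReal_Gps`; re-derived inline below to keep the import closure small).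

WHY.  [Balaban1985BackgroundPropagators] p. 395, after (3.26): *«It coincides with Δ_a in (2.19) if U = 1.»* — at the flat background Bałaban's `D_U R(U) D*_U` of (3.25)∕(3.26)
(built from `G′ = (Δ + aQ′*Q′)⁻¹`, a genuine inverse) reproduces [Balaban1984PropagatorsI] (1.69)'s `−∂Π∂*` with `Π = Δ⁻¹Q′*(Q′Δ⁻²Q′*)⁻¹Q′Δ⁻¹` ((1.26), built from the
PSEUDO-inverse `Δ⁻¹` vanishing on constants — b05's `PcT`, n15-a part 46's `landauRe`).  The two projections DIFFER by the projection onto constants (`I − R(1) = PcT + P_𝟙`,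
the T4Continuum cell's `Pone_eq`, proved there over `ℂ`), and the difference is killed by the outer gradient.  THIS FILE reads the model objects of n15-c∕197 at `T ≡ 1` as the
REAL PARTS of those typed complex matrices (`lapAFlat = re DeltaPs`, `greenFlat = re Gps`, `sopFlat = re Kone`, `piFlat = re Pone` at `a = a′·n^{d+1}`) and concludes: the Landau
perturbation letter `N_V^R := landauCov(U) − landauRe ⊗ 1_ι` of the sequel VANISHES at `U ≡ 1` — the starting point of every perturbative row.  (The same dictionary on the
Hilbert-space carriers of the NE9 chain is `B9Eq321FlatProjectionDictionary` — cited, not restated.)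

RESULTS ([folklore] linear algebra; the (2.19)∕(3.26) tag marks the printed sentence the capstone transcribes in the model).
* §1 THE FLAT LETTERS ARE REAL PARTS OF THE T4Continuum CELL's TYPED MATRICES: `conj_n`, `gradFlatT_mul_gradFlat` (`∂ᵀ∂ = re Δ`), `isReal_Kone`,
  `lapAFlat_eq_reM` (`= re DeltaPs` at `a = a′n^{d+1}`), `greenFlat_eq_reM` (`= re Gps`), `sopFlat_eq_reM` (`= re Kone`), ★ `piFlat_eq_reM` (`= re Pone`),
  ★★ **`piFlat_eq : piFlat M n a = reM PcT + reM P_𝟙`** (every `a > 0`; `Pone_eq` read on the reals).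
* §2 ★★ **`landauFlat_eq : landauFlat M n a = reM (∂·PcT·∂ᴴ)`** ((3.26) «coincides with Δ_a in (2.19) if U = 1»), `mulVecLin_kronecker_one`,
  ★★★ **`landauCov_one_eq : Matrix.mulVecLin (landauCov M n 1 a) = tensorId ι (landauRe M n)`** (the knit's currency).

HONEST FRAMING ∕ LIMITS.  Finite linear algebra (`a > 0`); no estimate; MODEL READING as n15-c∕197 (in particular the model `Δ′_a` has uniform weights — irrelevant here: the
projection is weight-blind).  NOT [Balaban1985BackgroundPropagators] Thms 3.1–3.3; NE2⁺ NOT PRINTED; N15 of record untouched (DISCHARGED AS CONSUMED, p687738); counts UNMOVED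
(typed 28∕28); one finite 𝕋⁴ at fixed ε per index — NOT infinite volume ∕ OS ∕ mass gap ∕ Clay.  Restate-immune (no Theses import).
-/

noncomputable section

open scoped BigOperators Matrix Kronecker
open Finset

namespace Summit.QuantumFields.YangMills.BalabanUVNodes.N15.CovLandau

open Literature.MathematicalPhysics.QuantumFieldTheory.Balaban1983to89
open Literature.MathematicalPhysics.QuantumFieldTheory.Balaban1983to89.B5Prop11Plancherel (Tor fine unitVec)
open Literature.MathematicalPhysics.QuantumFieldTheory.Balaban1983to89.B5Block118 (QsOp)
open Literature.MathematicalPhysics.QuantumFieldTheory.Balaban1983to89.B5Action121 (GradOp LapS)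
open Literature.MathematicalPhysics.QuantumFieldTheory.Balaban1983to89.B5LaplaceInverse (Pker)
open Literature.MathematicalPhysics.QuantumFieldTheory.Balaban1983to89.B5Value126 (PcT)
open Literature.MathematicalPhysics.QuantumFieldTheory.Balaban1983to89.B5RealFields (IsReal reM reM_add reM_smul_ofReal reM_conjTranspose isReal_GradOp isReal_LapS isReal_Pker isReal_QsOp isReal_PcT)
open Summit.QuantumFields.BalabanUV.T4Continuum.ScalarAveragedPropagator (DeltaPs Gps DeltaPs_mul_Gps)
open Summit.QuantumFields.BalabanUV.T4Continuum.ScalarBlockPoincare (PiS)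
open Summit.QuantumFields.BalabanUV.T4Continuum.ScalarGaugeProjectionUnit (Kone Pone Pone_eq isUnit_det_Kone GradOp_mul_Pker)
open Summit.QuantumFields.YangMills.BalabanUVNodes.N15.VectorPiece (tensorId tensorId_apply)
open Summit.QuantumFields.YangMills.BalabanUVNodes.N15.TwoGrid (landauRe)

variable {d : ℕ} (M : Fin (d + 1) → ℕ) [∀ μ, NeZero (M μ)] (n : ℕ) [NeZero n]

/-! ## §1 The flat letters are the real parts of the T4Continuum cell's typed matrices; `I − R(1) = PcT + P_𝟙` -/

section Letters

omit [NeZero n] in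
/-- `conj n = n`. [folklore] -/
theorem conj_n : (starRingEnd ℂ) (n : ℂ) = n := map_natCast _ n

/-- `∂ᵀ∂ = re Δ` (b05's `∂ᴴ∂ = Δ` read on real scalars). [cite: Balaban1984PropagatorsI, (1.21) p.21] -/
theorem gradFlatT_mul_gradFlat : (gradFlat M n)ᵀ * gradFlat M n = reM (LapS (fine n M) (n : ℂ)) := by
  rw [gradFlat, ← reM_conjTranspose, ← (isReal_GradOp (fine n M) (conj_n n)).conjTranspose.reM_mul (isReal_GradOp (fine n M) (conj_n n)),
    B5Action121.GradOp_conjTranspose_mul_GradOp]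

/-- `Kone = Q′G′G′Q′ᴴ` is a real matrix (with the reality of `DeltaPs`, `Gps` — GAN24's `ScalarFlatLift.isReal_DeltaPs`∕`isReal_Gps`, inlined). [folklore] -/
theorem isReal_Kone (a' : ℝ) : IsReal (DeltaPs n M a') ∧ IsReal (Gps n M a') ∧ IsReal (Kone n M a') := by
  have hD : IsReal (DeltaPs n M a') := by
    refine (isReal_LapS (fine n M) (conj_n n)).add (IsReal.smul (Complex.conj_ofReal _) (IsReal.smul ?_ ((isReal_QsOp n M).conjTranspose.mul (isReal_QsOp n M))))
    rw [map_pow, conj_n]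
  have hG : IsReal (Gps n M a') := hD.inv
  exact ⟨hD, hG, (((isReal_QsOp n M).mul hG).mul hG).mul (isReal_QsOp n M).conjTranspose⟩

/-- The model's flat `Δ′_a` at `a = a′·n^{d+1}` is the real part of the cell's `DeltaPs a′`. [cite: Balaban1985BackgroundPropagators, (3.24) p.394 (at `U ≡ 1`)] -/
theorem lapAFlat_eq_reM (a' : ℝ) : lapAFlat M n (a' * (n : ℝ) ^ (d + 1)) = reM (DeltaPs n M a') := by
  have hQ := isReal_QsOp n M
  rw [lapAFlat, gradFlatT_mul_gradFlat, DeltaPs, PiS, reM_add, smul_smul, show ((a' : ℂ) * (n : ℂ) ^ (d + 1)) = (((a' * (n : ℝ) ^ (d + 1) : ℝ)) : ℂ) by push_cast; ring,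
    reM_smul_ofReal, hQ.conjTranspose.reM_mul hQ, reM_conjTranspose, qsFlat]

/-- The model's flat `G′` is the real part of the cell's `Gps` (`a′ > 0`). [cite: Balaban1985BackgroundPropagators, (3.25) p.394 (at `U ≡ 1`)] -/
theorem greenFlat_eq_reM {a' : ℝ} (ha' : 0 < a') : greenFlat M n (a' * (n : ℝ) ^ (d + 1)) = reM (Gps n M a') := by
  rw [greenFlat, lapAFlat_eq_reM, (isReal_Kone M n a').1.reM_inv (DeltaPs_mul_Gps n M ha'), Gps]

/-- The model's flat `Q′G′²Q′ᵀ` is the real part of the cell's `Kone` (`a′ > 0`). [cite: Balaban1985BackgroundPropagators, (3.25) p.394 (at `U ≡ 1`)] -/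
theorem sopFlat_eq_reM {a' : ℝ} (ha' : 0 < a') : sopFlat M n (a' * (n : ℝ) ^ (d + 1)) = reM (Kone n M a') := by
  have hQ := isReal_QsOp n M
  have hG := (isReal_Kone M n a').2.1
  rw [sopFlat, greenFlat_eq_reM M n ha', Kone, ((hQ.mul hG).mul hG).reM_mul hQ.conjTranspose, (hQ.mul hG).reM_mul hG, hQ.reM_mul hG, reM_conjTranspose, qsFlat]
  simp only [Matrix.mul_assoc]

/-- ★ The model's flat `I − R(1)` is the real part of the cell's `Pone` (`a′ > 0`). [cite: Balaban1985BackgroundPropagators, (3.25) p.394 (at `U ≡ 1`)] -/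
theorem piFlat_eq_reM {a' : ℝ} (ha' : 0 < a') : piFlat M n (a' * (n : ℝ) ^ (d + 1)) = reM (Pone n M a') := by
  have hQ := isReal_QsOp n M
  obtain ⟨-, hG, hK⟩ := isReal_Kone M n a'
  rw [piFlat, sopFlat_eq_reM M n ha', greenFlat_eq_reM M n ha', hK.reM_inv (Matrix.mul_nonsing_inv _ (isUnit_det_Kone n M ha')), Pone,
    (((hG.mul hQ.conjTranspose).mul hK.inv).mul hQ).reM_mul hG, ((hG.mul hQ.conjTranspose).mul hK.inv).reM_mul hQ, (hG.mul hQ.conjTranspose).reM_mul hK.inv,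
    hG.reM_mul hQ.conjTranspose, reM_conjTranspose, qsFlat]

/-- ★★ **THE TWO PROJECTIONS: `I − R(1) = PcT + P_𝟙`** for every `a > 0` — the T4Continuum cell's `Pone_eq` read on the reals through `piFlat_eq_reM` at `a′ = a∕n^{d+1}`.
[cite: Balaban1985BackgroundPropagators, (3.25)–(3.26) p.394–395; Balaban1984PropagatorsI, (1.26) p.22] -/
theorem piFlat_eq {a : ℝ} (ha : 0 < a) : piFlat M n a = reM (PcT n M (n : ℂ)) + reM (Pker (fine n M) (n : ℂ)) := by
  have hn : (0 : ℝ) < (n : ℝ) ^ (d + 1) := pow_pos (Nat.cast_pos.mpr (Nat.pos_of_ne_zero (NeZero.ne n))) _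
  have ha' : 0 < a / (n : ℝ) ^ (d + 1) := div_pos ha hn
  have hre : a = a / (n : ℝ) ^ (d + 1) * (n : ℝ) ^ (d + 1) := (div_mul_cancel₀ a hn.ne').symm
  rw [hre, piFlat_eq_reM M n ha', Pone_eq n M ha', reM_add]

end Letters

/-! ## §2 The covariant Landau term at `U ≡ 1` is `landauRe ⊗ 1_ι` -/

section Landau

/-- ★★ **«IT COINCIDES WITH `Δ_a` IN (2.19) IF `U = 1`»: `∂(I − R(1))∂ᵀ = re (∂·PcT·∂ᴴ)`** — the model's flat Landau term IS b05's `∂Π∂*` of (1.69) (`a > 0`).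
[cite: Balaban1985BackgroundPropagators, (3.26) p.395; Balaban1984PropagatorsI, (1.69) p.29] -/
theorem landauFlat_eq {a : ℝ} (ha : 0 < a) : landauFlat M n a = reM (GradOp (fine n M) (n : ℂ) * PcT n M (n : ℂ) * (GradOp (fine n M) (n : ℂ))ᴴ) := by
  have hG := isReal_GradOp (fine n M) (conj_n n)
  have hP := isReal_PcT n M (conj_n n)
  have h0 : gradFlat M n * reM (Pker (fine n M) (n : ℂ)) = 0 := by
    rw [gradFlat, ← hG.reM_mul (isReal_Pker (fine n M) (conj_n n)), GradOp_mul_Pker]; rfl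
  rw [landauFlat, piFlat_eq M n ha, Matrix.mul_add, Matrix.add_mul, h0, Matrix.zero_mul, add_zero, (hG.mul hP).reM_mul hG.conjTranspose, hG.reM_mul hP,
    reM_conjTranspose, gradFlat]

omit [∀ μ, NeZero (M μ)] [NeZero n] M n in
/-- Tensoring with `1_ι` is the lane's `tensorId` at the level of linear maps. [folklore] -/
theorem mulVecLin_kronecker_one {X : Type} [Fintype X] [DecidableEq X] {ι : Type} [Fintype ι] [DecidableEq ι] (A : Matrix X X ℝ) :
    Matrix.mulVecLin (A ⊗ₖ (1 : Matrix ι ι ℝ)) = tensorId ι (Matrix.mulVecLin A) := by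
  refine LinearMap.ext fun f => funext fun ⟨x, i⟩ => ?_
  rw [Matrix.mulVecLin_apply, tensorId_apply, Matrix.mulVecLin_apply]
  simp only [Matrix.mulVec, dotProduct, Fintype.sum_prod_type, Matrix.kroneckerMap_apply, Matrix.one_apply, mul_ite, mul_one, mul_zero, ite_mul, zero_mul,
    Finset.sum_ite_eq, Finset.mem_univ, if_true]

/-- ★★★ **THE COVARIANT LANDAU TERM AT `U ≡ 1` IS THE COVER KNIT's FLAT `∂Π∂* ⊗ 1_ι`**: `mulVecLin (landauCov 1 a) = tensorId ι (landauRe M n)` (`a > 0`) — the Landau perturbation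
letter of the sequel vanishes at the flat background. [cite: Balaban1985BackgroundPropagators, (3.26) p.395 («It coincides with Δ_a in (2.19) if U = 1»); Balaban1984PropagatorsI, (1.69) p.29] -/
theorem landauCov_one_eq {a : ℝ} (ha : 0 < a) (ι : Type) [Fintype ι] [DecidableEq ι] :
    Matrix.mulVecLin (landauCov M n (fun (_ : Fin (d + 1)) (_ : Tor (fine n M)) => (1 : Matrix ι ι ℝ)) a) = tensorId ι (landauRe M n) := by
  rw [landauCov_one, landauFlat_eq M n ha, mulVecLin_kronecker_one]
  rfl

end Landau

end Summit.QuantumFields.YangMills.BalabanUVNodes.N15.CovLandau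

end
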